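import Mathlib
import Summits.Schanuel.Schanuel.Theses.RigidCore
import Summits.Schanuel.Schanuel.Theorems.RigidCoreMinimalCounterexampleInAclWindowRecurrenceBranch
import Summits.Schanuel.Schanuel.Theorems.RigidCoreMinimalCounterexampleInAclWindowRigidityCoset

/-!
# Window finiteness on a branch, for a hit family with finite exponential fibres
# (crux stmt-Schanuel-0969 `RigidCore.MinimalCounterexampleInAcl`)

Line `kernel-arithmetic-selection` (lead prover-line-stmt-Schanuel-0969-c12-0), `--supports stmt-Schanuel-0969`;
infrastructure for the registered stub `stub_corankOne_noFullLine` (no full line of mates in corank one, every rank).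

Rank-free form of the per-branch half of the rank-2 window-recurrence theorem (`branch_phase_nondegenerate`,
`branch_window_finite`, Theorems/…WindowRecurrenceBranchPhase, …WindowRecurrenceBranch, lead c3).  There the curve
`W ⊆ ℂ² × ℂ²` was defined over `ℚ`, which entered at exactly ONE point: a fibre `{eˣ = ω}` carries finitely many
independent exponential points of a `ℚ`-curve (`finite_indepExpPoints_fibre`, Hermite–Lindemann).  Here `W` is any
Zariski closed set of dimension `< 2`, the hits are taken from an arbitrary family `Q ⊆ indepExpPoints W`, and the
fibre finiteness of `Q` is a HYPOTHESIS (`hfib`); the proofs are otherwise those of lead c3, verbatim: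

* `branch_phase_nondegenerate_of_fibre` — on a branch at infinity `𝔟(t) = ((t⁻ᵉ, Φ₁ t/tᴺ), (Φ₂ t/tᴺ, Φ₃ t/tᴺ)) ⊆ W`
  over a coset `c + 2πiℤ` whose `Q`-hits accumulate at `t = 0`: `y₀ ≡ eᶜ`, `y₁` is not log-type
  (`false_of_logType_pole`), so `y₁ = e^{ℓ₁(t)}`, and the meromorphic phase `M = x₁ − ℓ₁` is NOT a polynomial in
  `t⁻ᵉ` (else `ℓ₁`, `e^{ℓ₁}` are algebraic over `ℂ[x̂₀]` by `isAlgebraic_coords_of_branch`, `ℓ₁` is constant by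
  `eventually_const_of_isAlgebraic_exp`, and infinitely many `Q`-hits lie in one fibre `eˣ = ω`, against `hfib`);
* `branch_window_finite_of_fibre` — hence, by the landed COSET WINDOW RIGIDITY `stub_windowRigidity_coset`
  (Theorems/…WindowRigidityCoset), windows of length `≥ N + 3` of `Q`-hits on the branch recur at finitely many
  positions;
* `stub_noFullLineBranchWindow` — the registered explicit-binder form.
In the application (Theorems/…NoFullLine) `W` is the slice curve of a corank-one first failure over the field of
constants of a rational line, `Q` the family of slice points of the mates on the line, and `hfib` is branch
finiteness of kernel classes of mates (`branch_finite_voc`).  References: the tree's cusp machinery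
`Literature/NumberTheory/Transcendental/ExpPoints*.lean`; card `Cruxes/MinimalCounterexampleInAcl/Ideas/arithmetic-isolation.md`.
-/

noncomputable section

set_option linter.dupNamespace false

open Complex Filter Topology Set Metric Polynomial

namespace Summit.Schanuel.Schanuel.Cruxes.MinimalCounterexampleInAcl.KernelArithmeticSelection

open Literature.NumberTheory.Transcendental
open Literature.Analysis.Complex.LaurentGerm
open Literature.Analysis.Complex.MeromorphicGerm (analyticAt_pow_succ_mul_div_pow analyticAt_pow_succ_mul_inv_pow)
open Literature.Analysis.Complex.BranchOrders (exists_zpow_exp_form)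

/-- The Taylor series of `f : ℂ → ℂ` at `0` (local notation, as in the tree's cusp files). -/
local notation3 "𝓣[" f "]" =>
  (PowerSeries.mk fun n => ((Nat.factorial n : ℂ)⁻¹ * iteratedDeriv n f 0) : PowerSeries ℂ)

/-- The Laurent expansion at `0` of a germ `f` with `zⁿ f(z)` analytic at `0` (local notation). -/
local notation3 "𝓛[" n ", " f "]" =>
  (HahnSeries.single (-((n : ℕ) : ℤ)) (1 : ℂ) *
    HahnSeries.ofPowerSeries ℤ ℂ 𝓣[fun z : ℂ => z ^ (n : ℕ) * (f : ℂ → ℂ) z] : LaurentSeries ℂ)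

/-- The branch point `((t⁻ᵉ, Φ₁ t / tᴺ), (Φ₂ t / tᴺ, Φ₃ t / tᴺ)) ∈ ℂ² × ℂ²` (local notation). -/
local notation3 "𝔟[" e ", " N ", " Φ₁ ", " Φ₂ ", " Φ₃ ", " t "]" =>
  (Sum.elim ![((t : ℂ) ^ (e : ℕ))⁻¹, (Φ₁ : ℂ → ℂ) t / t ^ (N : ℕ)]
    ![(Φ₂ : ℂ → ℂ) t / t ^ (N : ℕ), (Φ₃ : ℂ → ℂ) t / t ^ (N : ℕ)] : Fin 2 ⊕ Fin 2 → ℂ)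

section Branch

variable {W : Set (Fin 2 ⊕ Fin 2 → ℂ)} {e N : ℕ} {Φ₁ Φ₂ Φ₃ : ℂ → ℂ} {Q : Set (Fin 2 → ℂ)}

/-- **The phase of a branch carrying infinitely many coset hits of a fibre-finite family is a non-degenerate
meromorphic germ** (rank-free form of `branch_phase_nondegenerate`; see the module docstring). [folklore] -/
theorem branch_phase_nondegenerate_of_fibre
    (hdim : zariskiDim ℂ W < 2) (he : 0 < e) {r : ℝ} (hr : 0 < r)
    (hana : ∀ t : ℂ, ‖t‖ < r → AnalyticAt ℂ Φ₁ t ∧ AnalyticAt ℂ Φ₂ t ∧ AnalyticAt ℂ Φ₃ t)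
    (hWb : ∀ t : ℂ, 0 < ‖t‖ → ‖t‖ < r → 𝔟[e, N, Φ₁, Φ₂, Φ₃, t] ∈ W) (c : ℂ)
    (hQ : Q ⊆ indepExpPoints W) (hfib : ∀ ω : Fin 2 → ℂ, Set.Finite {x : Fin 2 → ℂ | x ∈ Q ∧ cexp ∘ x = ω})
    (hhitc : ∀ δ : ℝ, 0 < δ → Set.Infinite {x | x ∈ Q ∧
      (∃ m : ℤ, x 0 = c + 2 * ↑Real.pi * I * (m : ℂ)) ∧
      ∃ t : ℂ, 0 < ‖t‖ ∧ ‖t‖ < δ ∧ Sum.elim x (cexp ∘ x) = 𝔟[e, N, Φ₁, Φ₂, Φ₃, t]}) :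
    ∃ ℓ₁ : ℂ → ℂ, AnalyticAt ℂ ℓ₁ 0 ∧ (∀ᶠ t in 𝓝[≠] (0 : ℂ), Φ₃ t / t ^ N = cexp (ℓ₁ t)) ∧
      AnalyticAt ℂ (fun t : ℂ => t ^ (N + 1) * (Φ₁ t / t ^ N - ℓ₁ t)) 0 ∧
      ¬ ∃ Q : Polynomial ℂ, ∀ᶠ t in 𝓝[≠] (0 : ℂ), Φ₁ t / t ^ N - ℓ₁ t = Q.eval (t ^ e)⁻¹ := by
  classical
  obtain ⟨hΦ₁, hΦ₂, hΦ₃⟩ := hana 0 (by rw [norm_zero]; exact hr)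
  have hhit : ∀ δ : ℝ, 0 < δ → Set.Infinite {x | x ∈ indepExpPoints W ∧ ∃ t : ℂ, 0 < ‖t‖ ∧
      ‖t‖ < δ ∧ Sum.elim x (cexp ∘ x) = 𝔟[e, N, Φ₁, Φ₂, Φ₃, t]} :=
    fun δ hδ => (hhitc δ hδ).mono fun x hx => ⟨hQ hx.1, hx.2.2⟩
  have hfreq : ∀ {P : ℂ → Prop}, (∀ (x : Fin 2 → ℂ) (t : ℂ), x ∈ indepExpPoints W → 0 < ‖t‖ → ‖t‖ < r →
      Sum.elim x (cexp ∘ x) = 𝔟[e, N, Φ₁, Φ₂, Φ₃, t] → (∃ m : ℤ, x 0 = c + 2 * ↑Real.pi * I * (m : ℂ)) → P t) →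
      ∃ᶠ t in 𝓝[≠] (0 : ℂ), P t := by
    intro P hP
    refine Literature.Analysis.Complex.MeromorphicGerm.frequently_nhdsNE_of_forall_exists fun ε hε => ?_
    obtain ⟨x, hxI, hm, t, ht0, htε, hxt⟩ := (hhitc (min ε r) (lt_min hε hr)).nonempty
    exact ⟨t, ht0, htε.trans_le (min_le_left _ _),
      hP x t (hQ hxI) ht0 (htε.trans_le (min_le_right _ _)) hxt hm⟩
  -- the branch is eventually in `W`
  have hWev : ∀ᶠ t in 𝓝[≠] (0 : ℂ), 𝔟[e, N, Φ₁, Φ₂, Φ₃, t] ∈ W := by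
    have hball : ∀ᶠ t in 𝓝[≠] (0 : ℂ), ‖t‖ < r :=
      eventually_nhdsWithin_of_eventually_nhds
        (eventually_norm_sub_lt 0 hr |>.mono fun t ht => by simpa using ht)
    filter_upwards [hball, self_mem_nhdsWithin] with t ht ht0
    have htne : t ≠ 0 := by rintro rfl; exact ht0 (Set.mem_singleton 0)
    exact hWb t (norm_pos_iff.2 htne) ht
  -- (B2) `y₀ ≡ eᶜ` on the branch
  have hy₀ev : ∀ᶠ t in 𝓝[≠] (0 : ℂ), Φ₂ t / t ^ N = t ^ (0 : ℤ) * cexp ((fun _ : ℂ => c) t) := by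
    set F : ℂ → ℂ := fun t => Φ₂ t - cexp c * t ^ N with hF
    have hFan : AnalyticAt ℂ F 0 := hΦ₂.sub (analyticAt_const.mul (analyticAt_id.pow N))
    have hFfreq : ∃ᶠ t in 𝓝[≠] (0 : ℂ), F t = 0 := by
      refine hfreq fun x t _ ht0 _ hxt hm => ?_
      obtain ⟨m, hm⟩ := hm
      obtain ⟨-, -, h2, -⟩ := coords_of_eq_branch hxt
      have htne : t ≠ 0 := norm_pos_iff.1 ht0
      have hexp0 : cexp (x 0) = cexp c := by
        rw [hm, Complex.exp_add, mul_comm (2 * ↑Real.pi * I) (m : ℂ), Complex.exp_int_mul_two_pi_mul_I, mul_one]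
      rw [hF]
      show Φ₂ t - cexp c * t ^ N = 0
      have h' : cexp c = Φ₂ t / t ^ N := hexp0.symm.trans h2
      rw [h', div_mul_cancel₀ _ (pow_ne_zero N htne), sub_self]
    have hFev : ∀ᶠ t in 𝓝 (0 : ℂ), F t = 0 := hFan.frequently_zero_iff_eventually_zero.1 hFfreq
    filter_upwards [eventually_nhdsWithin_of_eventually_nhds hFev, self_mem_nhdsWithin] with t ht ht0
    have htne : t ≠ 0 := by rintro rfl; exact ht0 (Set.mem_singleton 0)
    rw [zpow_zero, one_mul]
    rw [hF] at ht
    have : Φ₂ t = cexp c * t ^ N := sub_eq_zero.1 ht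
    rw [this]
    field_simp
  -- (B3) the multiplicative form of `y₁`
  have hne₃ : ∃ᶠ t in 𝓝[≠] (0 : ℂ), Φ₃ t ≠ 0 := by
    refine hfreq fun x t _ _ _ hxt _ h0 => ?_
    obtain ⟨-, -, -, h3⟩ := coords_of_eq_branch hxt
    rw [h0, zero_div] at h3
    exact Complex.exp_ne_zero _ h3
  obtain ⟨μ₁, -, -, ℓ₁, -, -, hℓ₁, -, -, -, hy₁⟩ := exists_zpow_exp_form hΦ₃ hne₃ N
  -- (B4) `y₁` is not log-type: `μ₁ = 0`
  have hμ₁ : μ₁ = 0 := by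
    by_contra hμ
    refine false_of_logType_pole (W := W) (e := e) (N := N) (Φ₂ := Φ₂) hΦ₁ hhit (μ₀ := 0)
      (ℓ₀ := fun _ : ℂ => c) analyticAt_const hℓ₁ hy₀ev hy₁ (Or.inr hμ) ?_
    rintro ⟨Φh, hΦh, hev⟩
    have hcont : ContinuousAt Φh 0 := hΦh.continuousAt
    obtain ⟨δ₁, hδ₁, hB⟩ : ∃ δ₁ > 0, ∀ t : ℂ, ‖t‖ < δ₁ → ‖Φh t‖ < ‖Φh 0‖ + 1 := by
      have h := Metric.continuousAt_iff.1 hcont 1 one_pos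
      obtain ⟨δ₁, hδ₁, h⟩ := h
      refine ⟨δ₁, hδ₁, fun t ht => ?_⟩
      have := h (by simpa [dist_eq_norm] using ht)
      rw [dist_eq_norm] at this
      calc ‖Φh t‖ = ‖(Φh t - Φh 0) + Φh 0‖ := by ring_nf
        _ ≤ ‖Φh t - Φh 0‖ + ‖Φh 0‖ := norm_add_le _ _
        _ < ‖Φh 0‖ + 1 := by linarith
    obtain ⟨δ₂, hδ₂, hev'⟩ := exists_radius_of_eventually hev
    set Bd : ℝ := (‖Φh 0‖ + 1) / ‖(μ₁ : ℂ)‖ + ‖c‖ + 1 with hBd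
    have hμne : (μ₁ : ℂ) ≠ 0 := by exact_mod_cast hμ
    have hμpos : 0 < ‖(μ₁ : ℂ)‖ := norm_pos_iff.2 hμne
    have hBdpos : 0 < Bd := by rw [hBd]; positivity
    set τ : ℝ := min (min δ₁ δ₂) (Bd⁻¹ ^ ((e : ℝ)⁻¹)) / 2 with hτ
    have hmpos : 0 < min (min δ₁ δ₂) (Bd⁻¹ ^ ((e : ℝ)⁻¹)) :=
      lt_min (lt_min hδ₁ hδ₂) (Real.rpow_pos_of_pos (inv_pos.2 hBdpos) _)
    have hτpos : 0 < τ := by rw [hτ]; linarith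
    have hτlt : τ < min (min δ₁ δ₂) (Bd⁻¹ ^ ((e : ℝ)⁻¹)) := by rw [hτ]; linarith
    have hτδ₁ : τ < δ₁ := hτlt.trans_le ((min_le_left _ _).trans (min_le_left _ _))
    have hτδ₂ : τ < δ₂ := hτlt.trans_le ((min_le_left _ _).trans (min_le_right _ _))
    have hτB : τ < Bd⁻¹ ^ ((e : ℝ)⁻¹) := hτlt.trans_le (min_le_right _ _)
    set t : ℂ := (τ : ℂ) with ht
    have htnorm : ‖t‖ = τ := by rw [ht, Complex.norm_real, Real.norm_eq_abs, abs_of_pos hτpos]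
    have ht0 : 0 < ‖t‖ := by rw [htnorm]; exact hτpos
    have hid := hev' t ht0 (by rw [htnorm]; exact hτδ₂)
    simp only [Int.cast_zero, zero_mul, sub_zero] at hid
    -- `μ₁ ((t^e)⁻¹ - c) = Φh t`, so `‖(t^e)⁻¹‖ ≤ ‖Φh t‖/‖μ₁‖ + ‖c‖ < Bd`
    have hinv : (t ^ e)⁻¹ = Φh t / (μ₁ : ℂ) + c := by
      field_simp
      linear_combination hid
    have hle : ‖(t ^ e)⁻¹‖ < Bd := by
      rw [hinv]
      calc ‖Φh t / (μ₁ : ℂ) + c‖ ≤ ‖Φh t / (μ₁ : ℂ)‖ + ‖c‖ := norm_add_le _ _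
        _ = ‖Φh t‖ / ‖(μ₁ : ℂ)‖ + ‖c‖ := by rw [norm_div]
        _ < (‖Φh 0‖ + 1) / ‖(μ₁ : ℂ)‖ + ‖c‖ + 1 := by
            have := hB t (by rw [htnorm]; exact hτδ₁)
            have h2 : ‖Φh t‖ / ‖(μ₁ : ℂ)‖ ≤ (‖Φh 0‖ + 1) / ‖(μ₁ : ℂ)‖ :=
              div_le_div_of_nonneg_right this.le hμpos.le
            linarith
    -- but `‖(t^e)⁻¹‖ = τ^{-e} > Bd`
    have hge : Bd < ‖(t ^ e)⁻¹‖ := by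
      rw [norm_inv, norm_pow, htnorm]
      have hτe : τ ^ e < (Bd⁻¹ ^ ((e : ℝ)⁻¹)) ^ e := pow_lt_pow_left₀ hτB hτpos.le he.ne'
      have heq : (Bd⁻¹ ^ ((e : ℝ)⁻¹)) ^ e = Bd⁻¹ := by
        rw [← Real.rpow_natCast, ← Real.rpow_mul (inv_nonneg.2 hBdpos.le), inv_mul_cancel₀ (by exact_mod_cast he.ne'),
          Real.rpow_one]
      rw [heq] at hτe
      have := (inv_lt_inv₀ (inv_pos.2 hBdpos) (pow_pos hτpos e)).2 hτe
      rwa [inv_inv] at this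
    exact absurd (hle.trans hge) (lt_irrefl _)
  subst hμ₁
  simp only [zpow_zero, one_mul] at hy₁
  -- (B5) the meromorphic phase `M = x₁ − ℓ₁(t)`
  set M : ℂ → ℂ := fun t => Φ₁ t / t ^ N - ℓ₁ t with hM
  have raise : ∀ {f : ℂ → ℂ} {n K : ℕ}, AnalyticAt ℂ (fun t : ℂ => t ^ n * f t) 0 → n ≤ K →
      AnalyticAt ℂ (fun t : ℂ => t ^ K * f t) 0 := by
    intro f n K hf hle
    obtain ⟨k, rfl⟩ := Nat.exists_eq_add_of_le hle
    exact analyticAt_pow_add hf k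
  have hf₁ : AnalyticAt ℂ (fun t : ℂ => t ^ (N + 1) * (Φ₁ t / t ^ N)) 0 := analyticAt_pow_succ_mul_div_pow hΦ₁ N
  have hℓK : AnalyticAt ℂ (fun t : ℂ => t ^ (N + 1) * ℓ₁ t) 0 :=
    raise (f := ℓ₁) (n := 0) (by simpa using hℓ₁) (Nat.zero_le _)
  have hMan : AnalyticAt ℂ (fun t : ℂ => t ^ (N + 1) * M t) 0 := by
    have hneg : AnalyticAt ℂ (fun t : ℂ => t ^ (N + 1) * (-ℓ₁ t)) 0 := by
      simpa using analyticAt_const_mul hℓK (-1)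
    simpa [hM, sub_eq_add_neg] using analyticAt_add hf₁ hneg
  -- (B6) `M` is not a polynomial in `(t^e)⁻¹`
  have hndeg : ¬ ∃ Q : Polynomial ℂ, ∀ᶠ t in 𝓝[≠] (0 : ℂ), M t = Q.eval (t ^ e)⁻¹ := by
    rintro ⟨Q, hQ⟩
    have req : ∀ {f : ℂ → ℂ} {n K : ℕ} (hf : AnalyticAt ℂ (fun t : ℂ => t ^ n * f t) 0) (hle : n ≤ K),
        𝓛[K, f] = 𝓛[n, f] := fun hf hle => laurent_eq_of_analyticAt (raise hf hle) hf
    have hf₀ : AnalyticAt ℂ (fun t : ℂ => t ^ (e + 1) * (t ^ e)⁻¹) 0 := analyticAt_pow_succ_mul_inv_pow e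
    have hg₀ : AnalyticAt ℂ (fun t : ℂ => t ^ (N + 1) * (Φ₂ t / t ^ N)) 0 := analyticAt_pow_succ_mul_div_pow hΦ₂ N
    have hg₁ : AnalyticAt ℂ (fun t : ℂ => t ^ (N + 1) * (Φ₃ t / t ^ N)) 0 := analyticAt_pow_succ_mul_div_pow hΦ₃ N
    have hx₀ : 𝓛[e + 1, fun t : ℂ => (t ^ e)⁻¹] = HahnSeries.single (-(e : ℤ)) (1 : ℂ) := (laurent_inv_pow e).1
    have htr₀ : Transcendental ℂ 𝓛[e + 1, fun t : ℂ => (t ^ e)⁻¹] := by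
      rw [hx₀]
      refine transcendental_of_coeff_ne_zero (n := -(e : ℤ)) (by omega) ?_
      rw [HahnSeries.coeff_single_same]; exact one_ne_zero
    obtain ⟨ha₁, -, ha₃⟩ := isAlgebraic_coords_of_branch hdim hf₀ hf₁ hg₀ hg₁ hWev htr₀
    set a : LaurentSeries ℂ := 𝓛[e + 1, fun t : ℂ => (t ^ e)⁻¹] with ha
    set R' := Algebra.adjoin ℂ ({a} : Set (LaurentSeries ℂ)) with hR'
    -- the Laurent expansion of `Q((t^e)⁻¹)` lies in `R'`
    set P : MvPolynomial (Fin 2) ℂ := Polynomial.aeval (MvPolynomial.X 0 : MvPolynomial (Fin 2) ℂ) Q with hP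
    have hPeval : ∀ t : ℂ, MvPolynomial.eval ![(t ^ e)⁻¹, (t ^ e)⁻¹] P = Q.eval (t ^ e)⁻¹ := by
      intro t
      have h := Polynomial.aeval_algHom_apply (MvPolynomial.aeval ![(t ^ e)⁻¹, (t ^ e)⁻¹])
        (MvPolynomial.X 0 : MvPolynomial (Fin 2) ℂ) Q
      rw [MvPolynomial.aeval_X, Matrix.cons_val_zero] at h
      have h2 : MvPolynomial.eval ![(t ^ e)⁻¹, (t ^ e)⁻¹] P = MvPolynomial.aeval ![(t ^ e)⁻¹, (t ^ e)⁻¹] P := by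
        rw [← MvPolynomial.coe_aeval_eq_eval]; rfl
      rw [h2, hP, ← h, Polynomial.coe_aeval_eq_eval]
    set K₀ : ℕ := ((e + 1) + (e + 1)) * P.totalDegree with hK₀
    obtain ⟨hLQ, hQan⟩ := laurent_eval hf₀ hf₀ P (N := K₀) le_rfl
    have hrange : Set.range ![a, a] = {a} := by
      ext z
      simp only [Set.mem_range, Set.mem_singleton_iff]
      constructor
      · rintro ⟨i, rfl⟩; fin_cases i <;> rfl
      · rintro rfl; exact ⟨0, rfl⟩
    have hQmem : (MvPolynomial.aeval ![a, a] P : LaurentSeries ℂ) ∈ R' := by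
      rw [hR', ← hrange, Algebra.adjoin_range_eq_range_aeval]
      exact ⟨P, rfl⟩
    have hQalg : IsAlgebraic R' (MvPolynomial.aeval ![a, a] P : LaurentSeries ℂ) :=
      isAlgebraic_algebraMap (⟨_, hQmem⟩ : R')
    -- `ℓ₁ = x₁ − Q((t^e)⁻¹)` on a punctured neighbourhood
    have hℓeq : ∀ᶠ t in 𝓝[≠] (0 : ℂ), ℓ₁ t = Φ₁ t / t ^ N - MvPolynomial.eval ![(t ^ e)⁻¹, (t ^ e)⁻¹] P := by
      filter_upwards [hQ] with t ht
      rw [hPeval, ← ht, hM]; ring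
    -- the Laurent expansion of `ℓ₁` is algebraic over `ℂ[x̂₀]`
    set K : ℕ := (N + 1) + K₀ with hK
    have hf₁K : AnalyticAt ℂ (fun t : ℂ => t ^ K * (Φ₁ t / t ^ N)) 0 := raise hf₁ (Nat.le_add_right _ _)
    have hQK : AnalyticAt ℂ (fun t : ℂ => t ^ K * MvPolynomial.eval ![(t ^ e)⁻¹, (t ^ e)⁻¹] P) 0 :=
      raise hQan (Nat.le_add_left _ _)
    have hℓ₁K : AnalyticAt ℂ (fun t : ℂ => t ^ K * ℓ₁ t) 0 :=
      raise (f := ℓ₁) (n := 0) (by simpa using hℓ₁) (Nat.zero_le _)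
    have hdiffK : AnalyticAt ℂ
        (fun t : ℂ => t ^ K * (Φ₁ t / t ^ N - MvPolynomial.eval ![(t ^ e)⁻¹, (t ^ e)⁻¹] P)) 0 := by
      have hneg : AnalyticAt ℂ (fun t : ℂ => t ^ K * (-MvPolynomial.eval ![(t ^ e)⁻¹, (t ^ e)⁻¹] P)) 0 := by
        simpa using analyticAt_const_mul hQK (-1)
      simpa [sub_eq_add_neg] using analyticAt_add hf₁K hneg
    have hℓhat : 𝓛[0, ℓ₁] = 𝓛[N + 1, fun t : ℂ => Φ₁ t / t ^ N] - MvPolynomial.aeval ![a, a] P := by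
      have h1 : 𝓛[0, ℓ₁] = 𝓛[K, ℓ₁] := (req (f := ℓ₁) (n := 0) (by simpa using hℓ₁) (Nat.zero_le _)).symm
      have h2 := laurent_sub hf₁K hQK
      have h3 := laurent_congr hℓ₁K hdiffK hℓeq
      beta_reduce at h2 h3
      rw [h1, h3, h2, req hf₁ (Nat.le_add_right _ _), req hQan (Nat.le_add_left _ _), hLQ]
    have h₁ : IsAlgebraic R' 𝓛[0, ℓ₁] := by
      rw [hℓhat]
      exact ha₁.sub hQalg
    -- the Laurent expansion of `e^{ℓ₁} = y₁` is algebraic over `ℂ[x̂₀]`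
    have hexpan : AnalyticAt ℂ (fun t => cexp (ℓ₁ t)) 0 := analyticAt_cexp.comp hℓ₁
    have hEK : AnalyticAt ℂ (fun t : ℂ => t ^ (N + 1) * cexp (ℓ₁ t)) 0 :=
      raise (f := fun t => cexp (ℓ₁ t)) (n := 0) (by simpa using hexpan) (Nat.zero_le _)
    have hEeq : 𝓛[N + 1, fun t : ℂ => Φ₃ t / t ^ N] = 𝓛[N + 1, fun t : ℂ => cexp (ℓ₁ t)] :=
      laurent_congr hg₁ hEK hy₁
    have h₂ : IsAlgebraic R' 𝓛[0, fun t => cexp (ℓ₁ t)] := by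
      rw [← req (f := fun t => cexp (ℓ₁ t)) (n := 0) (K := N + 1) (by simpa using hexpan) (Nat.zero_le _), ← hEeq]
      exact ha₃
    have hconst : ∀ᶠ t in 𝓝 (0 : ℂ), ℓ₁ t = ℓ₁ 0 := eventually_const_of_isAlgebraic_exp hℓ₁ h₁ h₂
    -- hence infinitely many independent points in the fibre over `(eᶜ, e^{ℓ₁ 0})`
    obtain ⟨δ₃, hδ₃, hδ₃P⟩ := exists_radius_of_eventually
      ((eventually_nhdsWithin_of_eventually_nhds hconst).and (hy₁.and hy₀ev))
    refine (hfib ![cexp c, cexp (ℓ₁ 0)]).not_infinite ((hhitc δ₃ hδ₃).mono ?_)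
    rintro x ⟨hxI, -, t, ht0, htδ, hxt⟩
    obtain ⟨hc1, hc2, hc3⟩ := hδ₃P t ht0 htδ
    obtain ⟨-, -, h2, h3⟩ := coords_of_eq_branch hxt
    refine ⟨hxI, funext fun i => ?_⟩
    fin_cases i
    · show cexp (x 0) = cexp c
      rw [h2, hc3, zpow_zero, one_mul]
    · show cexp (x 1) = cexp (ℓ₁ 0)
      rw [h3, hc2, hc1]
  exact ⟨ℓ₁, hℓ₁, hy₁, hMan, hndeg⟩

/-- **Per-branch window finiteness for a fibre-finite hit family** (rank-free form of `branch_window_finite`): on a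
branch at infinity `𝔟 ⊆ W` (`W` Zariski closed, `dim W < 2`) over a coset `c + 2πiℤ`, windows of `Q`-hits of length
`≥ N + 3` recur at finitely many positions — trivially if the branch carries finitely many `Q`-hits, and by
`branch_phase_nondegenerate_of_fibre` and the coset window rigidity `stub_windowRigidity_coset` otherwise. [folklore] -/
theorem branch_window_finite_of_fibre
    (hdim : zariskiDim ℂ W < 2) (he : 0 < e) {r : ℝ} (hr : 0 < r)
    (hana : ∀ t : ℂ, ‖t‖ < r → AnalyticAt ℂ Φ₁ t ∧ AnalyticAt ℂ Φ₂ t ∧ AnalyticAt ℂ Φ₃ t)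
    (hWb : ∀ t : ℂ, 0 < ‖t‖ → ‖t‖ < r → 𝔟[e, N, Φ₁, Φ₂, Φ₃, t] ∈ W) (c : ℂ)
    (hQ : Q ⊆ indepExpPoints W) (hfib : ∀ ω : Fin 2 → ℂ, Set.Finite {x : Fin 2 → ℂ | x ∈ Q ∧ cexp ∘ x = ω}) :
    ∃ L : ℕ, ∀ G : Finset ℤ, L ≤ G.card →
      Set.Finite {k : ℤ | ∀ j ∈ G, ∃ x ∈ Q, ∃ t : ℂ,
        t = (x 0) ^ (-((e : ℂ)⁻¹)) ∧ x 0 = c + 2 * ↑Real.pi * I * ((k + j : ℤ) : ℂ) ∧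
        0 < ‖t‖ ∧ ‖t‖ < r ∧ Sum.elim x (cexp ∘ x) = 𝔟[e, N, Φ₁, Φ₂, Φ₃, t]} := by
  classical
  refine ⟨N + 3, fun G hG => ?_⟩
  set Hit : ℤ → Prop := fun m => ∃ x ∈ Q, ∃ t : ℂ,
      t = (x 0) ^ (-((e : ℂ)⁻¹)) ∧ x 0 = c + 2 * ↑Real.pi * I * (m : ℂ) ∧
      0 < ‖t‖ ∧ ‖t‖ < r ∧ Sum.elim x (cexp ∘ x) = 𝔟[e, N, Φ₁, Φ₂, Φ₃, t] with hHit
  have hGne : G.Nonempty := Finset.card_pos.1 (by omega)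
  obtain ⟨j₀, hj₀⟩ := hGne
  have hsub : {k : ℤ | ∀ j ∈ G, ∃ x ∈ Q, ∃ t : ℂ,
        t = (x 0) ^ (-((e : ℂ)⁻¹)) ∧ x 0 = c + 2 * ↑Real.pi * I * ((k + j : ℤ) : ℂ) ∧
        0 < ‖t‖ ∧ ‖t‖ < r ∧ Sum.elim x (cexp ∘ x) = 𝔟[e, N, Φ₁, Φ₂, Φ₃, t]} ⊆
      (fun k => k + j₀) ⁻¹' {m | Hit m} := fun k hk => hk j₀ hj₀
  by_cases hfin : {m : ℤ | Hit m}.Finite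
  · exact (hfin.preimage (add_left_injective j₀).injOn).subset hsub
  -- ### Case B: infinitely many coset hits on this branch
  have hinf : {m : ℤ | Hit m}.Infinite := hfin
  obtain ⟨hΦ₁, hΦ₂, hΦ₃⟩ := hana 0 (by rw [norm_zero]; exact hr)
  -- (B0) small parameters: hits with large `x 0` have small `t`
  have hsmall : ∀ {x : Fin 2 → ℂ} {t : ℂ} {δ : ℝ}, 0 < δ → Sum.elim x (cexp ∘ x) = 𝔟[e, N, Φ₁, Φ₂, Φ₃, t] →
      0 < ‖t‖ → δ⁻¹ ^ e < ‖x 0‖ → ‖t‖ < δ := by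
    intro x t δ hδ hxt ht hx0
    obtain ⟨h0, -, -, -⟩ := coords_of_eq_branch hxt
    rw [h0] at hx0
    exact norm_lt_of_inv_pow hδ (norm_pos_iff.1 ht) hx0
  -- (B1) the coset hits accumulate at `t = 0`
  have hhitc : ∀ δ : ℝ, 0 < δ → Set.Infinite {x | x ∈ Q ∧
      (∃ m : ℤ, x 0 = c + 2 * ↑Real.pi * I * (m : ℂ)) ∧
      ∃ t : ℂ, 0 < ‖t‖ ∧ ‖t‖ < δ ∧ Sum.elim x (cexp ∘ x) = 𝔟[e, N, Φ₁, Φ₂, Φ₃, t]} := by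
    intro δ hδ
    set S : Set ℤ := {m | Hit m} \ {m | ‖c + 2 * ↑Real.pi * I * (m : ℂ)‖ ≤ δ⁻¹ ^ e} with hS
    have hSinf : S.Infinite := hinf.sdiff (finite_int_norm_coset_le c _)
    set pick : ℤ → (Fin 2 → ℂ) := fun m => if h : Hit m then h.choose else 0 with hpick
    have hpick : ∀ m, Hit m → pick m ∈ Q ∧ ∃ t : ℂ,
        t = (pick m 0) ^ (-((e : ℂ)⁻¹)) ∧ pick m 0 = c + 2 * ↑Real.pi * I * (m : ℂ) ∧
        0 < ‖t‖ ∧ ‖t‖ < r ∧ Sum.elim (pick m) (cexp ∘ pick m) = 𝔟[e, N, Φ₁, Φ₂, Φ₃, t] := by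
      intro m hm
      have h := hm.choose_spec
      simp only [hpick, dif_pos hm]
      exact ⟨h.1, h.2⟩
    refine Set.infinite_of_injOn_mapsTo (f := pick) ?_ ?_ hSinf
    · intro m hm m' hm' heq
      obtain ⟨-, t, -, h0, -⟩ := hpick m hm.1
      obtain ⟨-, t', -, h0', -⟩ := hpick m' hm'.1
      have : (c + 2 * ↑Real.pi * I * (m : ℂ)) = c + 2 * ↑Real.pi * I * (m' : ℂ) := by rw [← h0, ← h0', heq]
      have h2 : (m : ℂ) = (m' : ℂ) := by
        have hne : (2 * ↑Real.pi * I : ℂ) ≠ 0 := by simp [Real.pi_ne_zero, I_ne_zero]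
        exact mul_left_cancel₀ hne (by linear_combination this)
      exact_mod_cast h2
    · intro m hm
      obtain ⟨hxI, t, -, h0, ht0, htr, hxt⟩ := hpick m hm.1
      have hlt : δ⁻¹ ^ e < ‖pick m 0‖ := by
        rw [h0]; exact lt_of_not_ge hm.2
      exact ⟨hxI, ⟨m, h0⟩, t, ht0, hsmall hδ hxt ht0 hlt, hxt⟩
  -- (B2)–(B6) the phase of the branch
  obtain ⟨ℓ₁, hℓ₁, hy₁, hMan, hndeg⟩ := branch_phase_nondegenerate_of_fibre hdim he hr hana hWb c hQ hfib hhitc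
  -- (B7) coset window rigidity (the landed `stub_windowRigidity_coset`)
  have hfinR := stub_windowRigidity_coset e (N + 1) (fun t : ℂ => Φ₁ t / t ^ N - ℓ₁ t) c G he hMan hndeg
    (by omega)
  obtain ⟨δ₂, hδ₂, hδ₂P⟩ := exists_radius_of_eventually hy₁
  set Bad : Set ℤ := ⋃ j ∈ G, {k : ℤ | ‖c + 2 * ↑Real.pi * I * ((k + j : ℤ) : ℂ)‖ ≤ δ₂⁻¹ ^ e} with hBad
  have hBadfin : Bad.Finite := by
    refine Set.Finite.biUnion G.finite_toSet fun j _ => ?_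
    exact (finite_int_norm_coset_le c (δ₂⁻¹ ^ e)).preimage (f := fun k : ℤ => k + j) (add_left_injective j).injOn
  refine (hfinR.union hBadfin).subset ?_
  intro k hk
  by_cases hkB : k ∈ Bad
  · exact Or.inr hkB
  refine Or.inl fun j hj => ?_
  obtain ⟨x, -, t, htdef, hx0, ht0, -, hxt⟩ := hk j hj
  have hlarge : δ₂⁻¹ ^ e < ‖x 0‖ := by
    rw [hx0]
    by_contra hle
    exact hkB (Set.mem_iUnion₂.2 ⟨j, hj, not_lt.1 hle⟩)
  have htδ : ‖t‖ < δ₂ := hsmall hδ₂ hxt ht0 hlarge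
  have hy := hδ₂P t ht0 htδ
  obtain ⟨-, h1, -, h3⟩ := coords_of_eq_branch hxt
  have hexp : cexp (Φ₁ t / t ^ N) = cexp (ℓ₁ t) := by rw [← h1, h3, hy]
  obtain ⟨n, hn⟩ := Complex.exp_eq_exp_iff_exists_int.1 hexp
  refine ⟨n, ?_⟩
  rw [← hx0, ← htdef]
  show Φ₁ t / t ^ N - ℓ₁ t = (n : ℂ) * (2 * ↑Real.pi * I)
  rw [hn]; ring

end Branch

/-- **Registered helper `stub_noFullLineBranchWindow` (PROVED)** — explicit-binder form of `branch_window_finite_of_fibre`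
(helper for `stub_corankOne_noFullLine`). [folklore] -/
theorem stub_noFullLineBranchWindow : ∀ (W : Set (Fin 2 ⊕ Fin 2 → ℂ)) (Q : Set (Fin 2 → ℂ)) (e N : ℕ) (Φ₁ Φ₂ Φ₃ : ℂ → ℂ) (r : ℝ) (c : ℂ), Literature.NumberTheory.Transcendental.zariskiDim ℂ W < 2 → 0 < e → 0 < r → (∀ t : ℂ, ‖t‖ < r → AnalyticAt ℂ Φ₁ t ∧ AnalyticAt ℂ Φ₂ t ∧ AnalyticAt ℂ Φ₃ t) → (∀ t : ℂ, 0 < ‖t‖ → ‖t‖ < r → (Sum.elim ![(t ^ e)⁻¹, Φ₁ t / t ^ N] ![Φ₂ t / t ^ N, Φ₃ t / t ^ N] : Fin 2 ⊕ Fin 2 → ℂ) ∈ W) → Q ⊆ Literature.NumberTheory.Transcendental.indepExpPoints W → (∀ ω : Fin 2 → ℂ, Set.Finite {x : Fin 2 → ℂ | x ∈ Q ∧ Complex.exp ∘ x = ω}) → ∃ L : ℕ, ∀ G : Finset ℤ, L ≤ G.card → Set.Finite {k : ℤ | ∀ j ∈ G, ∃ x ∈ Q, ∃ t : ℂ, t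 = (x 0) ^ (-((e : ℂ)⁻¹)) ∧ x 0 = c + 2 * ↑Real.pi * Complex.I * ((k + j : ℤ) : ℂ) ∧ 0 < ‖t‖ ∧ ‖t‖ < r ∧ Sum.elim x (Complex.exp ∘ x) = (Sum.elim ![(t ^ e)⁻¹, Φ₁ t / t ^ N] ![Φ₂ t / t ^ N, Φ₃ t / t ^ N] : Fin 2 ⊕ Fin 2 → ℂ)} :=
  fun _ _ _ _ _ _ _ _ c hdim he hr hana hWb hQ hfib => branch_window_finite_of_fibre hdim he hr hana hWb c hQ hfib

end Summit.Schanuel.Schanuel.Cruxes.MinimalCounterexampleInAcl.KernelArithmeticSelection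

end
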